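import Summits.MatrixMultiplication.OmegaCensus.LocalUSPChartBound

/-!
# ω-census, family (b1-U): kernel row for width 9 (largest local USP found: 20 rows)

HONEST FRAMING (pub-omega census; verbatim): lottery ticket; floor = certified bounds/negative ranges.
Census bookkeeping, not progress on `ω`.  First submitted as an append to `LocalUSPInstancesK789.lean` (p205373, never verified during
the session — gate backlog on modified files); landed here as a sibling file (a later landing of the append would bounce on the duplicate
name, intended).  Width-9 local USP census (kit j081681): 20 rows found, 21 undecided within 1 800 s.  Recipe: `decide +kernel` (pattern
property; a one-off `maxHeartbeats` raise for the 8 000 ordered triples), `decide +kernel` (one integer inequality), `omega_le_div_of_isLocalUSP`.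
-/

noncomputable section

open Literature.Computability.AlgebraicComplexity

namespace Summit.MatrixMultiplication.OmegaCensus

-- one-off: the 20×9 pattern check (8 000 ordered triples) exceeds the default elaboration budget of `decide +kernel`
set_option maxHeartbeats 1600000 in
/-- Census row (b1-U) `w9_s20`: the local USP `{111122333 111313222 112132133 113312312 122113123 123311232 123332111 131312321 132231321 213312113 223211313 231113212 231231231 232131213 232321131 311223321 312133221 322111233 331211132 331321112}` (20 rows, width 9; pattern set `L ∪ {123}`; largest size FOUND by the SAT census at this width by 2026-08-20 (s = 21 undecided within 1 800 s; see FAMILY-B-TABLE)) through the CW chart with modulus `m = 25` certifies `ω ≤ 2.7614 = 13807/5000` (integer certificate `25^135000 ≤ 20^15000·23^124263`; exact value `3(9 log 25 − log 20)/(9 log 23) = 2.7613031…`). [cite: CohnKleinbergSzegedyUmans2005, Thm. 37 and §6.3] -/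
theorem omega_le_of_localUSP_w9_s20 : omega ℂ ≤ 2.7614 := by
  have h := omega_le_div_of_isLocalUSP (row := ![![0, 0, 0, 0, 1, 1, 2, 2, 2], ![0, 0, 0, 2, 0, 2, 1, 1, 1], ![0, 0, 1, 0, 2, 1, 0, 2, 2], ![0, 0, 2, 2, 0, 1, 2, 0, 1], ![0, 1, 1, 0, 0, 2, 0, 1, 2], ![0, 1, 2, 2, 0, 0, 1, 2, 1], ![0, 1, 2, 2, 2, 1, 0, 0, 0], ![0, 2, 0, 2, 0, 1, 2, 1, 0], ![0, 2, 1, 1, 2, 0, 2, 1, 0], ![1, 0, 2, 2, 0, 1, 0, 0, 2], ![1, 1, 2, 1, 0, 0, 2, 0, 2], ![1, 2, 0, 0, 0, 2, 1, 0, 1], ![1, 2, 0, 1, 2, 0, 1, 2, 0], ![1, 2, 1, 0, 2, 0, 1, 0, 2], ![1, 2, 1, 2, 1, 0, 0, 2, 0], ![2, 0, 0, 1, 1, 2, 2, 1, 0], ![2, 0, 1, 0, 2, 2, 1, 1, 0], ![2, 1, 1, 0, 0, 0, 1, 2, 2], ![2, 2, 0, 1, 0, 0, 0, 2, 1], ![2,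 2, 0, 2, 1, 0, 0, 0, 1]])
    (by unfold localStrongUSPPatterns; decide +kernel) (by norm_num) (by norm_num)
    (m := 25) (by norm_num) (a := 13807) (b := 5000) (by norm_num) (by decide +kernel)
  have e : ((13807 : ℕ) : ℝ) / ((5000 : ℕ) : ℝ) = 2.7614 := by norm_num
  rwa [e] at h

end Summit.MatrixMultiplication.OmegaCensus

end
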